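import Summits.MatrixMultiplication.OmegaCensus.C2C2QuaternionLaw
import HarnessLib

/-!
# `β(C₂³ × Q_{4m}) = 2β(C₂² × Q_{4m})` for `3 ∣ m` and for `m ≡ 1 (mod 6)`

ω-census, family (b3).  Framing: lottery ticket; floor = certified bounds/negative ranges.

`C₂³ × Q_{4m} = G(ℤ₂³ × ℤ_{2m}, (0,0,0,m))` (three applications of `c2_product_presentation`), `|A| = 16m ≡ m (mod 3)`,
quotient never cyclic.  For `3 ∣ m` the general law `V ≤ 128m/3` and for `m ≡ 1 (mod 6)` the P3 exclusion
`V ≤ law − 8 = (128m − 32)/3` (`tpp_volume_dicyclic_quot_noncyclic_le`) are attained by `(C₂, 1, 1) ×` an optimal triple of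
`C₂² × Q_{4m}` (`c2c2_quaternion_law`): **`c2c2c2_quaternion_law`** — e.g. `β(C₂³ × Q₁₂) = 128`, `β(C₂³ × Q₂₄) = 256`,
`β(C₂³ × Q₂₈) = 288`.  (`m ≡ 2 (mod 3)`: dicyclic law `(128m − 16)/3` vs product `(128m − 64)/3`, open; `m ≡ 4 (mod 6)`:
inherits the open window of `C₂² × Q_{4m}`.)
-/

namespace Summit.MatrixMultiplication.OmegaCensus

open Literature.Combinatorics.Additive Finset
open Summit.MatrixMultiplication.MatrixMultiplication.Theorems.JuntaBranch.Planting (tpp_product)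

section C2C2C2Q

variable {m : ℕ} [NeZero m]

/-- `A/⟨c₀⟩` is not cyclic for `A = ℤ₂ × (ℤ₂ × (ℤ₂ × ℤ_{2m}))`, `c₀ = (0,(0,(0,m)))` (project to `ℤ₂ × ℤ₂`). [folklore] -/
theorem z2_z2_z2_z2m_quot_noncyclic [NeZero (2 * m)] :
    (((0 : ZMod 2), (((0 : ZMod 2), (((0 : ZMod 2), (m : ZMod (2 * m))))))) :
        ZMod 2 × (ZMod 2 × (ZMod 2 × ZMod (2 * m)))) ≠ 0 ∧
    ¬ ∃ g : ZMod 2 × (ZMod 2 × (ZMod 2 × ZMod (2 * m))), ∀ x, x ∈ AddSubgroup.zmultiples g ∨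
      x + ((0 : ZMod 2), (((0 : ZMod 2), (((0 : ZMod 2), (m : ZMod (2 * m))))))) ∈ AddSubgroup.zmultiples g := by
  have hm0 : m ≠ 0 := NeZero.ne m
  refine ⟨fun h0 => ?_, ?_⟩
  · have h1 : (m : ZMod (2 * m)) = 0 :=
      congrArg (fun p : ZMod 2 × (ZMod 2 × (ZMod 2 × ZMod (2 * m))) => p.2.2.2) h0
    rw [ZMod.natCast_eq_zero_iff] at h1
    have := Nat.le_of_dvd (Nat.pos_of_ne_zero hm0) h1
    omega
  · rintro ⟨g, hg⟩
    apply not_cyclic_zmod_two_prod (k := 2) (dvd_refl 2)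
    refine ⟨(g.1, g.2.1), fun y => ?_⟩
    have key : ∀ e f : _, ((y.1, (y.2, (e, f))) : ZMod 2 × (ZMod 2 × (ZMod 2 × ZMod (2 * m)))) ∈
        AddSubgroup.zmultiples g → y ∈ AddSubgroup.zmultiples (g.1, g.2.1) := by
      intro e f he
      obtain ⟨k, hk⟩ := AddSubgroup.mem_zmultiples_iff.1 he
      refine AddSubgroup.mem_zmultiples_iff.2 ⟨k, ?_⟩
      have h1 := congrArg Prod.fst hk
      have h2 := congrArg (fun p : ZMod 2 × (ZMod 2 × (ZMod 2 × ZMod (2 * m))) => p.2.1) hk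
      simp only [Prod.smul_fst, Prod.smul_snd] at h1 h2
      exact Prod.ext h1 h2
    rcases hg (y.1, (y.2, (0, 0))) with h | h
    · exact key 0 0 h
    · refine key (0 : ZMod 2) (m : ZMod (2 * m)) ?_
      have e : ((y.1, (y.2, ((0 : ZMod 2), (0 : ZMod (2 * m))))) : ZMod 2 × (ZMod 2 × (ZMod 2 × ZMod (2 * m)))) +
          (0, (0, (0, (m : ZMod (2 * m))))) = (y.1, (y.2, (0, (m : ZMod (2 * m))))) :=
        Prod.ext (add_zero _) (Prod.ext (add_zero _) (Prod.ext (add_zero _) (zero_add _)))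
      rw [e] at h; exact h

/-- **Upper bound** for `C₂³ × Q_{4m}`: `3 ∣ m` (general law) or `m ≡ 1 (mod 6)` (P3 exclusion). [folklore] -/
theorem c2c2c2_quaternion_tpp_volume_le (hm : 3 ≤ m) (hmod : m % 3 = 0 ∨ m % 6 = 1)
    {S T U : Finset (Multiplicative (ZMod 2) × (Multiplicative (ZMod 2) × (Multiplicative (ZMod 2) × QuaternionGroup m)))}
    (h : TripleProductProperty S T U) :
    S.card * T.card * U.card ≤ if m % 6 = 1 then (128 * m - 32) / 3 else 64 * (2 * m / 3) := by
  haveI : NeZero (2 * m) := ⟨by omega⟩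
  obtain ⟨hc₀'', hnq⟩ := z2_z2_z2_z2m_quot_noncyclic (m := m)
  refine c2_quaternion_presentation (m := m) fun ρ τ c₀ hρρ hρτ hτρ hττ hρ hτ hne hsurj hc => ?_
  subst hc
  refine c2_product_presentation hρρ hρτ hτρ hττ hρ hτ hne hsurj
    fun ρ' τ' c₀' hρρ' hρτ' hτρ' hττ' hρ' hτ' hne' hsurj' hc' => ?_
  subst hc'
  refine c2_product_presentation hρρ' hρτ' hτρ' hττ' hρ' hτ' hne' hsurj'
    fun ρ'' τ'' c₀'' hρρ'' hρτ'' hτρ'' hττ'' hρ'' hτ'' hne'' hsurj'' hc'' => ?_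
  subst hc''
  have hcard : Fintype.card (ZMod 2 × (ZMod 2 × (ZMod 2 × ZMod (2 * m)))) = 16 * m := by
    rw [Fintype.card_prod, Fintype.card_prod, Fintype.card_prod, ZMod.card, ZMod.card]; ring
  by_cases h1 : m % 6 = 1
  · simp only [if_pos h1]
    have key := tpp_volume_dicyclic_quot_noncyclic_le hρρ'' hρτ'' hτρ'' hττ'' hc₀'' hnq hρ'' hτ'' hne'' hsurj''
      (by rw [hcard]; omega) (by rw [hcard]; omega) h
    rw [hcard] at key
    omega
  · simp only [if_neg h1]
    have h0 : m % 3 = 0 := by omega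
    have key := tpp_volume_le_of_dihedralLike hρρ'' hρτ'' hτρ'' hττ'' hρ'' hτ'' hne'' hsurj'' h
    rw [hcard] at key
    omega

/-- **Lower bound**: `(C₂, 1, 1) ×` an optimal triple of `C₂² × Q_{4m}` (`m ≥ 3`, `m ≢ 4 (mod 6)`). [folklore] -/
theorem c2c2c2_quaternion_volume_ge (hm : 3 ≤ m) (h4 : m % 6 ≠ 4) :
    ∃ S T U : Finset (Multiplicative (ZMod 2) × (Multiplicative (ZMod 2) × (Multiplicative (ZMod 2) × QuaternionGroup m))),
      TripleProductProperty S T U ∧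
      S.card * T.card * U.card = if m % 6 = 1 then (128 * m - 32) / 3 else 64 * (2 * m / 3) := by
  obtain ⟨-, S, T, U, h, hvol⟩ := c2c2_quaternion_law (m := m) hm h4
  refine ⟨univ ×ˢ S, {1} ×ˢ T, {1} ×ˢ U, tpp_product tpp_univ_one_one h, ?_⟩
  rw [card_product, card_product, card_product, card_univ, card_singleton, Fintype.card_multiplicative, ZMod.card]
  have e : 2 * S.card * (1 * T.card) * (1 * U.card) = 2 * (S.card * T.card * U.card) := by ring
  rw [e, hvol]
  by_cases h1 : m % 6 = 1
  · simp only [if_pos h1]; omega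
  · simp only [if_neg h1]; omega

/-- **`β(C₂³ × Q_{4m}) = 2β(C₂² × Q_{4m})` for `3 ∣ m` (`= 128m/3`) and for `m ≡ 1 (mod 6)` (`= (128m − 32)/3`)**
(kernel). [folklore] -/
theorem c2c2c2_quaternion_law (hm : 3 ≤ m) (hmod : m % 3 = 0 ∨ m % 6 = 1) :
    (∀ S T U : Finset (Multiplicative (ZMod 2) × (Multiplicative (ZMod 2) × (Multiplicative (ZMod 2) × QuaternionGroup m))),
        TripleProductProperty S T U →
        S.card * T.card * U.card ≤ if m % 6 = 1 then (128 * m - 32) / 3 else 64 * (2 * m / 3)) ∧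
    ∃ S T U : Finset (Multiplicative (ZMod 2) × (Multiplicative (ZMod 2) × (Multiplicative (ZMod 2) × QuaternionGroup m))),
      TripleProductProperty S T U ∧
      S.card * T.card * U.card = if m % 6 = 1 then (128 * m - 32) / 3 else 64 * (2 * m / 3) :=
  ⟨fun _ _ _ h => c2c2c2_quaternion_tpp_volume_le hm hmod h, c2c2c2_quaternion_volume_ge hm (by omega)⟩

end C2C2C2Q

end Summit.MatrixMultiplication.OmegaCensus
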